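import Summits.HodgeConjecture.CorCM.CommonQuarticCMSubfieldBiquadraticLattice
import Summits.HodgeConjecture.CorCM.ReflexFieldsMeetRealCMHodge
import HarnessLib

/-!
# Two CM types defined over CM biquadratic fields `F(α₀, β₀)`, `F(α₁, β₁)` over one real field `F`:
# additivity by FOUR RATIOS, and the Hodge conjecture on every `A₀^a × A₁^b`

COR-CM (cell `pub-hodgecm2`, binder seat `b16` gen 50, count-neutral claim CM44-COMMONQUARTIC, file F2; theorems only,
no definition, no named fact, no `sorry`).  NEW as stated, hence under `Summits/`.  HONEST FRAMING: the Hodge conjecture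
is obtained for NAMED products of CM abelian varieties from the tree's `ReflexFieldsMeetRealCMHodge`; `HC_CM` is neither
used nor asserted.

SETTING.  Two slots `i₀ ≠ i₁` (`I = {i₀, i₁}`), a subfield `F ⊂ ℝ` of `ℂ` of finite degree, and for `k = 0, 1` anti-real
numbers `α_k, β_k` (`ᾱ = −α`) with `α_k², β_k² ∈ F`, `α_k β_k ∉ F`, such that the type `Φ_{i_k}` is DEFINED OVER
`E_k = F(α_k, β_k)`: every automorphism of `ℂ` fixing `F` pointwise and fixing `α_k`, `β_k` stabilises `Φ_{i_k}`.  (For a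
one-unsplit-pair type of an octic CM field over a quartic CM subfield `k = k⁺(a)`: `F = z(k⁺)`, `α = z₁(a)`,
`β = x₂(b)` with `b` an anti-real element of the second quartic CM subfield — files F3/F4 of the claim.)

RESULT (F1's lattice engine `CMBiquad.conj_apply_eq_of_mem_of_mem` + the tree's real-intersection criterion): if none of
the FOUR RATIOS `α₀/α₁, α₀/β₁, β₀/α₁, β₀/β₁` lies in `F`, then `E₀ ∩ E₁ ⊂ ℝ`, so

* `isNondegenerateFamily_iff_forall_of_ratios` — the pair is nondegenerate iff both members are;
  `cmFamilyRank_add_card_eq_of_ratios` — rank additivity;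
* **`hodgeConjectureFor_prod_of_ratios`**, `not_exists_exceptional_prod_of_ratios` — for nondegenerate members the Hodge
  conjecture and `B• = D•` hold on every `⨁_{j<N} A_{π j}`, UNCONDITIONALLY.

A ratio in `F` means a coincidence `F(α₀) = F(α₁)` etc. of CM quadratic subfields of the two reflex fields; in the
`(4,4)` cell these coincidences are exactly the «common unsplit place» configurations (file F4).

## References

* [Gordon1999HodgeAVSurvey] B. B. Gordon, *A survey of the Hodge conjecture for abelian varieties*, §3 Theorem, 7.5–7.7,
  10.10.
* [Shimura1998] G. Shimura, *Abelian Varieties with Complex Multiplication and Modular Functions*, §8.3, §8.4 (2)(C).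
* [Lang2002] S. Lang, *Algebra*, VI §1.
-/

set_option autoImplicit false

noncomputable section

open scoped ComplexConjugate
open CategoryTheory CategoryTheory.Limits NumberField Module

namespace Summit.HodgeConjecture.CorCM

open Literature.NumberTheory.ComplexMultiplication
open Literature.AlgebraicGeometry.Motives (AbelianVariety CMType)
open Literature.AlgebraicGeometry.HodgeTheory
open Literature.AlgebraicGeometry.ComplexMultiplication (IsCMTypeRealisation)
open Literature.AlgebraicGeometry.VanGeemen1994 (hodgeClassSpan)
open Literature.AlgebraicGeometry.Pohlmann1968
open Literature.Barriers.HodgeConjecture (divisorClassesSpan)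

variable {I : Type} {K : I → Type} [∀ i, Field (K i)] [∀ i, NumberField (K i)] [∀ i, IsCMField (K i)] [Fintype I]
  [DecidableEq I] [Nonempty I] {Φ : ∀ i, CMType (K i)}
variable {F : IntermediateField ℚ ℂ} {α₀ β₀ α₁ β₁ : ℂ}

/-! ### §1 Automorphisms fixing `E = F ⊔ ℚ⟮α, β⟯` pointwise -/

omit [∀ i, NumberField (K i)] [∀ i, IsCMField (K i)] [Fintype I] [DecidableEq I] [Nonempty I] in
/-- If every `σ ∈ Aut(ℂ)` fixing `F` pointwise and fixing `α, β` stabilises `Φ_i`, then `E = F ⊔ ℚ⟮α, β⟯` is a field of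
definition of `Φ_i` in the sense of `ReflexFieldsMeetRealCMHodge`. [cite: Shimura1998, §8.3] -/
theorem forall_smul_mem_iff_of_fix_sup_adjoin {i : I} {α β : ℂ}
    (hdef : ∀ σ : ℂ ≃+* ℂ, (∀ t : ℂ, t ∈ F → σ t = t) → σ α = α → σ β = β →
      ∀ x : K i →+* ℂ, σ • x ∈ (Φ i).1 ↔ x ∈ (Φ i).1)
    (σ : ℂ ≃+* ℂ) (hσ : ∀ t : ℂ, t ∈ F ⊔ IntermediateField.adjoin ℚ {α, β} → σ t = t) :
    ∀ x : K i →+* ℂ, σ • x ∈ (Φ i).1 ↔ x ∈ (Φ i).1 :=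
  hdef σ (fun t ht => hσ t (CMBiquad.le_sup_adjoin (α := α) (β := β) ht)) (hσ α CMBiquad.left_mem_sup_adjoin)
    (hσ β CMBiquad.right_mem_sup_adjoin)

/-! ### §2 Types: additivity by four ratios -/

section Types

omit [∀ i, NumberField (K i)] [∀ i, IsCMField (K i)] [Fintype I] [DecidableEq I] [Nonempty I] in
/-- **`E₀ ∩ E₁ ⊂ ℝ` by four ratios** — F1's engine in the form consumed below. [cite: Lang2002, VI §1] -/
theorem conj_apply_eq_of_ratios (hF : ∀ t ∈ F, conj t = t) (hα₀ : conj α₀ = -α₀) (hβ₀ : conj β₀ = -β₀)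
    (hA₀ : α₀ * α₀ ∈ F) (hB₀ : β₀ * β₀ ∈ F) (hind₀ : α₀ * β₀ ∉ F) (hα₁ : conj α₁ = -α₁) (hβ₁ : conj β₁ = -β₁)
    (hA₁ : α₁ * α₁ ∈ F) (hB₁ : β₁ * β₁ ∈ F) (hind₁ : α₁ * β₁ ∉ F) (h₁ : ∀ f ∈ F, α₀ ≠ f * α₁)
    (h₂ : ∀ f ∈ F, α₀ ≠ f * β₁) (h₃ : ∀ f ∈ F, β₀ ≠ f * α₁) (h₄ : ∀ f ∈ F, β₀ ≠ f * β₁) :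
    ∀ z : ℂ, z ∈ F ⊔ IntermediateField.adjoin ℚ {α₀, β₀} → z ∈ F ⊔ IntermediateField.adjoin ℚ {α₁, β₁} →
      starRingEnd ℂ z = z :=
  CMBiquad.conj_apply_eq_of_mem_of_mem hF hα₀ hβ₀ hA₀ hB₀ hind₀ hα₁ hβ₁ hA₁ hB₁ hind₁ h₁ h₂ h₃ h₄

/-- **Additivity by four ratios (types).**  `I = {i₀, i₁}`; `F ⊂ ℝ` of finite degree; `Φ_{i₀}` defined over `F(α₀, β₀)`,
`Φ_{i₁}` over `F(α₁, β₁)` (CM biquadratic data over `F`); none of `α₀/α₁, α₀/β₁, β₀/α₁, β₀/β₁` in `F` ⟹ the pair is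
nondegenerate iff both members are. [cite: Gordon1999HodgeAVSurvey, §3 Theorem and 7.5–7.7] [cite: Shimura1998, §8.3] -/
theorem isNondegenerateFamily_iff_forall_of_ratios {i₀ i₁ : I} (h01 : i₀ ≠ i₁) (hI : ∀ j, j = i₀ ∨ j = i₁)
    [FiniteDimensional ℚ F] (hF : ∀ t ∈ F, conj t = t) (hα₀ : conj α₀ = -α₀) (hβ₀ : conj β₀ = -β₀)
    (hA₀ : α₀ * α₀ ∈ F) (hB₀ : β₀ * β₀ ∈ F) (hind₀ : α₀ * β₀ ∉ F) (hα₁ : conj α₁ = -α₁) (hβ₁ : conj β₁ = -β₁)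
    (hA₁ : α₁ * α₁ ∈ F) (hB₁ : β₁ * β₁ ∈ F) (hind₁ : α₁ * β₁ ∉ F)
    (hdef₀ : ∀ σ : ℂ ≃+* ℂ, (∀ t : ℂ, t ∈ F → σ t = t) → σ α₀ = α₀ → σ β₀ = β₀ →
      ∀ x : K i₀ →+* ℂ, σ • x ∈ (Φ i₀).1 ↔ x ∈ (Φ i₀).1)
    (hdef₁ : ∀ σ : ℂ ≃+* ℂ, (∀ t : ℂ, t ∈ F → σ t = t) → σ α₁ = α₁ → σ β₁ = β₁ →
      ∀ y : K i₁ →+* ℂ, σ • y ∈ (Φ i₁).1 ↔ y ∈ (Φ i₁).1)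
    (h₁ : ∀ f ∈ F, α₀ ≠ f * α₁) (h₂ : ∀ f ∈ F, α₀ ≠ f * β₁) (h₃ : ∀ f ∈ F, β₀ ≠ f * α₁)
    (h₄ : ∀ f ∈ F, β₀ ≠ f * β₁) :
    CMAlgebra.IsNondegenerateFamily Φ ↔ ∀ i, IsNondegenerate (Φ i) := by
  haveI := CMBiquad.finiteDimensional_sup_adjoin hA₀ hB₀
  haveI := CMBiquad.finiteDimensional_sup_adjoin hA₁ hB₁
  exact isNondegenerateFamily_iff_forall_of_fixingFields_inf_real h01 hI (F ⊔ IntermediateField.adjoin ℚ {α₀, β₀})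
    (F ⊔ IntermediateField.adjoin ℚ {α₁, β₁}) (forall_smul_mem_iff_of_fix_sup_adjoin hdef₀)
    (forall_smul_mem_iff_of_fix_sup_adjoin hdef₁)
    (conj_apply_eq_of_ratios hF hα₀ hβ₀ hA₀ hB₀ hind₀ hα₁ hβ₁ hA₁ hB₁ hind₁ h₁ h₂ h₃ h₄)

/-- **Rank additivity by four ratios**: `rank(Φ_{i₀}, Φ_{i₁}) + 2 = rank Φ_{i₀} + rank Φ_{i₁} + 1`.
[cite: Gordon1999HodgeAVSurvey, §3 Theorem (1)] -/
theorem cmFamilyRank_add_card_eq_of_ratios {i₀ i₁ : I} (h01 : i₀ ≠ i₁) (hI : ∀ j, j = i₀ ∨ j = i₁)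
    [FiniteDimensional ℚ F] (hF : ∀ t ∈ F, conj t = t) (hα₀ : conj α₀ = -α₀) (hβ₀ : conj β₀ = -β₀)
    (hA₀ : α₀ * α₀ ∈ F) (hB₀ : β₀ * β₀ ∈ F) (hind₀ : α₀ * β₀ ∉ F) (hα₁ : conj α₁ = -α₁) (hβ₁ : conj β₁ = -β₁)
    (hA₁ : α₁ * α₁ ∈ F) (hB₁ : β₁ * β₁ ∈ F) (hind₁ : α₁ * β₁ ∉ F)
    (hdef₀ : ∀ σ : ℂ ≃+* ℂ, (∀ t : ℂ, t ∈ F → σ t = t) → σ α₀ = α₀ → σ β₀ = β₀ →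
      ∀ x : K i₀ →+* ℂ, σ • x ∈ (Φ i₀).1 ↔ x ∈ (Φ i₀).1)
    (hdef₁ : ∀ σ : ℂ ≃+* ℂ, (∀ t : ℂ, t ∈ F → σ t = t) → σ α₁ = α₁ → σ β₁ = β₁ →
      ∀ y : K i₁ →+* ℂ, σ • y ∈ (Φ i₁).1 ↔ y ∈ (Φ i₁).1)
    (h₁ : ∀ f ∈ F, α₀ ≠ f * α₁) (h₂ : ∀ f ∈ F, α₀ ≠ f * β₁) (h₃ : ∀ f ∈ F, β₀ ≠ f * α₁)
    (h₄ : ∀ f ∈ F, β₀ ≠ f * β₁) :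
    CMAlgebra.cmFamilyRank Φ + Fintype.card I = (∑ i, cmTypeRank (Φ i)) + 1 := by
  haveI := CMBiquad.finiteDimensional_sup_adjoin hA₀ hB₀
  haveI := CMBiquad.finiteDimensional_sup_adjoin hA₁ hB₁
  exact cmFamilyRank_add_card_eq_of_fixingFields_inf_real h01 hI (F ⊔ IntermediateField.adjoin ℚ {α₀, β₀})
    (F ⊔ IntermediateField.adjoin ℚ {α₁, β₁}) (forall_smul_mem_iff_of_fix_sup_adjoin hdef₀)
    (forall_smul_mem_iff_of_fix_sup_adjoin hdef₁)
    (conj_apply_eq_of_ratios hF hα₀ hβ₀ hA₀ hB₀ hind₀ hα₁ hβ₁ hA₁ hB₁ hind₁ h₁ h₂ h₃ h₄)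

end Types

/-! ### §3 Abelian varieties -/

section Geometry

variable {A : I → AbelianVariety ℂ} {ι : ∀ i, 𝓞 (K i) →+* End (A i)}
  {θ : ∀ i, K i →+* Module.End ℂ (complexBetti (A i).X 1)}

/-- **The Hodge conjecture on every `A_{i₀}^a × A_{i₁}^b` by four ratios.**  For realisations of NONDEGENERATE types
defined over CM biquadratic fields `F(α₀, β₀)`, `F(α₁, β₁)` over one real field `F` with none of the four ratios in `F`:
HC and `B• = D•` on every `⨁_{j<N} A_{π j}` — UNCONDITIONALLY. [cite: Gordon1999HodgeAVSurvey, §3 Theorem and 10.10]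
[cite: Shimura1998, §8.3] -/
theorem hodgeConjectureFor_prod_of_ratios {i₀ i₁ : I} (h01 : i₀ ≠ i₁) (hI : ∀ j, j = i₀ ∨ j = i₁)
    [FiniteDimensional ℚ F] (hF : ∀ t ∈ F, conj t = t) (hα₀ : conj α₀ = -α₀) (hβ₀ : conj β₀ = -β₀)
    (hA₀ : α₀ * α₀ ∈ F) (hB₀ : β₀ * β₀ ∈ F) (hind₀ : α₀ * β₀ ∉ F) (hα₁ : conj α₁ = -α₁) (hβ₁ : conj β₁ = -β₁)
    (hA₁ : α₁ * α₁ ∈ F) (hB₁ : β₁ * β₁ ∈ F) (hind₁ : α₁ * β₁ ∉ F)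
    (hdef₀ : ∀ σ : ℂ ≃+* ℂ, (∀ t : ℂ, t ∈ F → σ t = t) → σ α₀ = α₀ → σ β₀ = β₀ →
      ∀ x : K i₀ →+* ℂ, σ • x ∈ (Φ i₀).1 ↔ x ∈ (Φ i₀).1)
    (hdef₁ : ∀ σ : ℂ ≃+* ℂ, (∀ t : ℂ, t ∈ F → σ t = t) → σ α₁ = α₁ → σ β₁ = β₁ →
      ∀ y : K i₁ →+* ℂ, σ • y ∈ (Φ i₁).1 ↔ y ∈ (Φ i₁).1)
    (h₁ : ∀ f ∈ F, α₀ ≠ f * α₁) (h₂ : ∀ f ∈ F, α₀ ≠ f * β₁) (h₃ : ∀ f ∈ F, β₀ ≠ f * α₁)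
    (h₄ : ∀ f ∈ F, β₀ ≠ f * β₁) (hnd : ∀ i, IsNondegenerate (Φ i))
    (hA : ∀ i, IsCMTypeRealisation (Φ i) (A i) (ι i) (θ i)) {N : ℕ} (π : Fin N → I) :
    HodgeConjectureFor (⨁ fun j : Fin N => A (π j)).dim (⨁ fun j : Fin N => A (π j)).X ∧
      ∀ m : ℕ, hodgeClassSpan (⨁ fun j : Fin N => A (π j)).dim (⨁ fun j : Fin N => A (π j)).X m =
        divisorClassesSpan (⨁ fun j : Fin N => A (π j)).X (⨁ fun j : Fin N => A (π j)).dim m := by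
  haveI := CMBiquad.finiteDimensional_sup_adjoin hA₀ hB₀
  haveI := CMBiquad.finiteDimensional_sup_adjoin hA₁ hB₁
  exact hodgeConjectureFor_prod_of_fixingFields_inf_real h01 hI (F ⊔ IntermediateField.adjoin ℚ {α₀, β₀})
    (F ⊔ IntermediateField.adjoin ℚ {α₁, β₁}) (forall_smul_mem_iff_of_fix_sup_adjoin hdef₀)
    (forall_smul_mem_iff_of_fix_sup_adjoin hdef₁)
    (conj_apply_eq_of_ratios hF hα₀ hβ₀ hA₀ hB₀ hind₀ hα₁ hβ₁ hA₁ hB₁ hind₁ h₁ h₂ h₃ h₄) hnd hA π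

/-- **No exceptional Hodge class on any `A_{i₀}^a × A_{i₁}^b`** under the same hypotheses.
[cite: Gordon1999HodgeAVSurvey, 7.5 and 7.6.1] -/
theorem not_exists_exceptional_prod_of_ratios {i₀ i₁ : I} (h01 : i₀ ≠ i₁) (hI : ∀ j, j = i₀ ∨ j = i₁)
    [FiniteDimensional ℚ F] (hF : ∀ t ∈ F, conj t = t) (hα₀ : conj α₀ = -α₀) (hβ₀ : conj β₀ = -β₀)
    (hA₀ : α₀ * α₀ ∈ F) (hB₀ : β₀ * β₀ ∈ F) (hind₀ : α₀ * β₀ ∉ F) (hα₁ : conj α₁ = -α₁) (hβ₁ : conj β₁ = -β₁)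
    (hA₁ : α₁ * α₁ ∈ F) (hB₁ : β₁ * β₁ ∈ F) (hind₁ : α₁ * β₁ ∉ F)
    (hdef₀ : ∀ σ : ℂ ≃+* ℂ, (∀ t : ℂ, t ∈ F → σ t = t) → σ α₀ = α₀ → σ β₀ = β₀ →
      ∀ x : K i₀ →+* ℂ, σ • x ∈ (Φ i₀).1 ↔ x ∈ (Φ i₀).1)
    (hdef₁ : ∀ σ : ℂ ≃+* ℂ, (∀ t : ℂ, t ∈ F → σ t = t) → σ α₁ = α₁ → σ β₁ = β₁ →
      ∀ y : K i₁ →+* ℂ, σ • y ∈ (Φ i₁).1 ↔ y ∈ (Φ i₁).1)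
    (h₁ : ∀ f ∈ F, α₀ ≠ f * α₁) (h₂ : ∀ f ∈ F, α₀ ≠ f * β₁) (h₃ : ∀ f ∈ F, β₀ ≠ f * α₁)
    (h₄ : ∀ f ∈ F, β₀ ≠ f * β₁) (hnd : ∀ i, IsNondegenerate (Φ i))
    (hA : ∀ i, IsCMTypeRealisation (Φ i) (A i) (ι i) (θ i)) {N : ℕ} (π : Fin N → I) (m : ℕ) :
    ¬∃ c : complexBetti (⨁ fun j : Fin N => A (π j)).X (2 * m), IsRationalClass c ∧
        IsOfHodgeType (⨁ fun j : Fin N => A (π j)).dim (⨁ fun j : Fin N => A (π j)).X (2 * m) m m c ∧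
        c ∉ divisorClassesSpan (⨁ fun j : Fin N => A (π j)).X (⨁ fun j : Fin N => A (π j)).dim m := by
  haveI := CMBiquad.finiteDimensional_sup_adjoin hA₀ hB₀
  haveI := CMBiquad.finiteDimensional_sup_adjoin hA₁ hB₁
  exact not_exists_exceptional_prod_of_fixingFields_inf_real h01 hI (F ⊔ IntermediateField.adjoin ℚ {α₀, β₀})
    (F ⊔ IntermediateField.adjoin ℚ {α₁, β₁}) (forall_smul_mem_iff_of_fix_sup_adjoin hdef₀)
    (forall_smul_mem_iff_of_fix_sup_adjoin hdef₁)
    (conj_apply_eq_of_ratios hF hα₀ hβ₀ hA₀ hB₀ hind₀ hα₁ hβ₁ hA₁ hB₁ hind₁ h₁ h₂ h₃ h₄) hnd hA π m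

end Geometry

end Summit.HodgeConjecture.CorCM

end
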